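import Literature.MathematicalPhysics.QuantumFieldTheory.CurvatureGaussianField
import Mathlib.MeasureTheory.Function.L2Space
import Mathlib.Analysis.Calculus.Deriv.Slope
import Mathlib.Analysis.SpecialFunctions.ExpDeriv
import Mathlib.Analysis.SpecialFunctions.Trigonometric.Bounds
import HarnessLib

/-!
# Rigidity of the lattice Maxwell field under the equipartition budget — part A (toolkit)

Route `EquipartitionCriticality` of `YangMills`, crux item `stmt-QuantumFields-8760`
(`EquipartitionPinsProbe`), line `Sketch`, STUB R (`stub_rigidity`) of the lead prover: every
probability measure `τ` on `ℝ^D`-valued 2-cochains `Y : ZdPlaquette 4 → Fin D → ℝ` of `ℤ⁴` that is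
a.s. closed, has uniformly bounded second moments with the equipartition budget, and satisfies the
(trigonometric) Stein identity of the lattice Maxwell field IS `curvatureGaussianField 4 D`.

This file is the elementary toolkit of that proof (no measure `τ`-specific hypothesis beyond
integrability): the pairing `⟨Y,h⟩_S = ∑_{p∈S}∑_a h_p^a Y_p^a` and the Gaussian quadratic form
`Q_S(h) = ∑_{p,q∈S}∑_a h_p^a h_q^a T(p,q)` (`T = curvatureTwoPoint`): linearity, scaling,
restriction to a larger index set, positive semidefiniteness of `Q_S`
(`isPosSemidefKernel_curvatureCovKernel`), the parallelogram bounds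
`Φ(∑_{m∈M} u_m) ≤ 2^{|M|} ∑ Φ(u_m)` for `Φ = Q_S` and for the second moment `E⟨Y,·⟩_S²`, the
indicator / line-average test cochains and their pairings, and the limit lemma reading the second
moment off `s ↦ e^{s²c} E cos(s X)`.
-/

noncomputable section

open MeasureTheory Filter Topology
open scoped BigOperators
open Literature.MathematicalPhysics.QuantumFieldTheory Literature.MathematicalPhysics.QuantumLattice
open Literature.Probability.LatticeModels

namespace Summit.QuantumFields.YangMills.Theorems.EquipartitionPinsProbe

namespace Rigidity

variable {D : ℕ}

/-! ### Measurability and integrability of pairings -/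

/-- Coordinates `Y ↦ Y p a` are measurable. -/
theorem measurable_eval (p : ZdPlaquette 4) (a : Fin D) :
    Measurable fun Y : ZdPlaquette 4 → Fin D → ℝ => Y p a :=
  (measurable_pi_apply a).comp (measurable_pi_apply p)

/-- Pairings `Y ↦ ⟨Y,h⟩_S` are continuous (finite sums of coordinates). -/
theorem continuous_pair (S : Finset (ZdPlaquette 4)) (h : ZdPlaquette 4 → Fin D → ℝ) :
    Continuous fun Y : ZdPlaquette 4 → Fin D → ℝ => ∑ p ∈ S, ∑ a : Fin D, h p a * Y p a := by
  refine continuous_finsetSum _ fun p _ => continuous_finsetSum _ fun a _ => ?_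
  have hpa : Continuous fun Y : ZdPlaquette 4 → Fin D → ℝ => Y p a :=
    (continuous_apply a).comp (continuous_apply p)
  exact continuous_const.mul hpa

/-- Square-integrable coordinates give square-integrable pairings. -/
theorem memLp_pair {τ : Measure (ZdPlaquette 4 → Fin D → ℝ)}
    (hY : ∀ (p : ZdPlaquette 4) (a : Fin D), Integrable (fun Y => (Y p a) ^ 2) τ)
    (S : Finset (ZdPlaquette 4)) (h : ZdPlaquette 4 → Fin D → ℝ) :
    MemLp (fun Y : ZdPlaquette 4 → Fin D → ℝ => ∑ p ∈ S, ∑ a : Fin D, h p a * Y p a) 2 τ := by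
  refine memLp_finsetSum S
    (f := fun p (Y : ZdPlaquette 4 → Fin D → ℝ) => ∑ a : Fin D, h p a * Y p a) fun p _ => ?_
  refine memLp_finsetSum Finset.univ
    (f := fun a (Y : ZdPlaquette 4 → Fin D → ℝ) => h p a * Y p a) fun a _ => ?_
  have hm : MemLp (fun Y : ZdPlaquette 4 → Fin D → ℝ => Y p a) 2 τ :=
    (memLp_two_iff_integrable_sq (measurable_eval p a).aestronglyMeasurable).2 (hY p a)
  exact hm.const_mul (h p a)

/-- The square of a pairing is integrable. -/
theorem integrable_pair_sq {τ : Measure (ZdPlaquette 4 → Fin D → ℝ)}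
    (hY : ∀ (p : ZdPlaquette 4) (a : Fin D), Integrable (fun Y => (Y p a) ^ 2) τ)
    (S : Finset (ZdPlaquette 4)) (h : ZdPlaquette 4 → Fin D → ℝ) :
    Integrable (fun Y : ZdPlaquette 4 → Fin D → ℝ => (∑ p ∈ S, ∑ a : Fin D, h p a * Y p a) ^ 2) τ :=
  (memLp_pair hY S h).integrable_sq

/-- Square-integrable coordinates are integrable (finite measure). -/
theorem integrable_eval {τ : Measure (ZdPlaquette 4 → Fin D → ℝ)} [IsFiniteMeasure τ]
    (hY : ∀ (p : ZdPlaquette 4) (a : Fin D), Integrable (fun Y => (Y p a) ^ 2) τ)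
    (p : ZdPlaquette 4) (a : Fin D) :
    Integrable (fun Y : ZdPlaquette 4 → Fin D → ℝ => Y p a) τ :=
  ((memLp_two_iff_integrable_sq (measurable_eval p a).aestronglyMeasurable).2 (hY p a)).integrable
    one_le_two

/-! ### Algebra of the pairing and of the quadratic form -/

/-- Pairing of a sum of test cochains. -/
theorem pair_add (S : Finset (ZdPlaquette 4)) (u v : ZdPlaquette 4 → Fin D → ℝ)
    (Y : ZdPlaquette 4 → Fin D → ℝ) :
    (∑ p ∈ S, ∑ a : Fin D, (u + v) p a * Y p a) =
      (∑ p ∈ S, ∑ a : Fin D, u p a * Y p a) + ∑ p ∈ S, ∑ a : Fin D, v p a * Y p a := by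
  simp only [Pi.add_apply, add_mul, Finset.sum_add_distrib]

/-- Pairing of a difference of test cochains. -/
theorem pair_sub (S : Finset (ZdPlaquette 4)) (u v : ZdPlaquette 4 → Fin D → ℝ)
    (Y : ZdPlaquette 4 → Fin D → ℝ) :
    (∑ p ∈ S, ∑ a : Fin D, (u - v) p a * Y p a) =
      (∑ p ∈ S, ∑ a : Fin D, u p a * Y p a) - ∑ p ∈ S, ∑ a : Fin D, v p a * Y p a := by
  simp only [Pi.sub_apply, sub_mul, Finset.sum_sub_distrib]

/-- Pairing of a finite sum of test cochains. -/
theorem pair_finset_sum {ι : Type*} (M : Finset ι) (u : ι → ZdPlaquette 4 → Fin D → ℝ)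
    (S : Finset (ZdPlaquette 4)) (Y : ZdPlaquette 4 → Fin D → ℝ) :
    (∑ p ∈ S, ∑ a : Fin D, (∑ m ∈ M, u m) p a * Y p a) =
      ∑ m ∈ M, ∑ p ∈ S, ∑ a : Fin D, u m p a * Y p a := by
  classical
  induction M using Finset.induction_on with
  | empty => simp
  | insert m M hm ih =>
    rw [Finset.sum_insert hm, Finset.sum_insert hm, pair_add, ih]

/-- Pairing of a scaled test cochain. -/
theorem pair_smul (S : Finset (ZdPlaquette 4)) (s : ℝ) (h : ZdPlaquette 4 → Fin D → ℝ)
    (Y : ZdPlaquette 4 → Fin D → ℝ) :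
    (∑ p ∈ S, ∑ a : Fin D, (s * h p a) * Y p a) = s * ∑ p ∈ S, ∑ a : Fin D, h p a * Y p a := by
  simp only [Finset.mul_sum, mul_assoc]

/-- The quadratic form of a scaled test cochain. -/
theorem quad_smul (S : Finset (ZdPlaquette 4)) (s : ℝ) (h : ZdPlaquette 4 → Fin D → ℝ) :
    (∑ p ∈ S, ∑ q ∈ S, ∑ a : Fin D, (s * h p a) * (s * h q a) * curvatureTwoPoint p q) =
      s ^ 2 * ∑ p ∈ S, ∑ q ∈ S, ∑ a : Fin D, h p a * h q a * curvatureTwoPoint p q := by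
  simp only [Finset.mul_sum]
  refine Finset.sum_congr rfl fun p _ => Finset.sum_congr rfl fun q _ =>
    Finset.sum_congr rfl fun a _ => ?_
  ring

/-- Parallelogram identity for the quadratic form. -/
theorem quad_parallelogram (S : Finset (ZdPlaquette 4)) (u v : ZdPlaquette 4 → Fin D → ℝ) :
    (∑ p ∈ S, ∑ q ∈ S, ∑ a : Fin D, (u + v) p a * (u + v) q a * curvatureTwoPoint p q) +
      (∑ p ∈ S, ∑ q ∈ S, ∑ a : Fin D, (u - v) p a * (u - v) q a * curvatureTwoPoint p q) =
      2 * (∑ p ∈ S, ∑ q ∈ S, ∑ a : Fin D, u p a * u q a * curvatureTwoPoint p q) +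
        2 * ∑ p ∈ S, ∑ q ∈ S, ∑ a : Fin D, v p a * v q a * curvatureTwoPoint p q := by
  simp only [Pi.add_apply, Pi.sub_apply, Finset.mul_sum, ← Finset.sum_add_distrib]
  refine Finset.sum_congr rfl fun p _ => Finset.sum_congr rfl fun q _ =>
    Finset.sum_congr rfl fun a _ => ?_
  ring

/-- **Positive semidefiniteness of the Gaussian quadratic form** (registered anchor of part A):
`Q_S(h) = ∑_{p,q∈S}∑_a h_p^a h_q^a T(p,q) ≥ 0` for the curvature kernel `T = curvatureTwoPoint`
(`isPosSemidefKernel_curvatureCovKernel`). -/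
theorem _root_.Summit.QuantumFields.YangMills.Theorems.EquipartitionPinsProbe.stub_rigidityQuadNonneg :
    ∀ (D : ℕ) (S : Finset (ZdPlaquette 4)) (h : ZdPlaquette 4 → Fin D → ℝ),
      0 ≤ ∑ p ∈ S, ∑ q ∈ S, ∑ a : Fin D, h p a * h q a * curvatureTwoPoint p q := by
  intro D S h
  classical
  set I : Finset (ZdPlaquette 4 × Fin D) := S ×ˢ Finset.univ with hI
  have hK := isPosSemidefKernel_curvatureCovKernel (d := 4) (by norm_num) D I
  let x : I → ℝ := fun s => h s.1.1 s.1.2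
  have hx : 0 ≤ dotProduct x ((covGram (curvatureCovKernel 4 D) I).mulVec x) := by
    simpa using hK.dotProduct_mulVec_nonneg x
  have e1 : dotProduct x ((covGram (curvatureCovKernel 4 D) I).mulVec x) =
      ∑ s : I, ∑ t : I, x s * (curvatureCovKernel 4 D s t * x t) := by
    simp only [dotProduct, Matrix.mulVec, covGram_apply, Finset.mul_sum]
  have e2 : (∑ s : I, ∑ t : I, x s * (curvatureCovKernel 4 D s t * x t)) =
      ∑ s ∈ I, ∑ t ∈ I, h s.1 s.2 * (curvatureCovKernel 4 D s t * h t.1 t.2) := by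
    rw [← Finset.sum_coe_sort I (fun s => ∑ t ∈ I,
      h s.1 s.2 * (curvatureCovKernel 4 D s t * h t.1 t.2))]
    refine Finset.sum_congr rfl fun s _ => ?_
    rw [← Finset.sum_coe_sort I (fun t => h s.1.1 s.1.2 * (curvatureCovKernel 4 D s t * h t.1 t.2))]
  have e3 : (∑ s ∈ I, ∑ t ∈ I, h s.1 s.2 * (curvatureCovKernel 4 D s t * h t.1 t.2)) =
      ∑ p ∈ S, ∑ q ∈ S, ∑ a : Fin D, h p a * h q a * curvatureTwoPoint p q := by
    rw [hI, Finset.sum_product]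
    refine Finset.sum_congr rfl fun p _ => ?_
    rw [Finset.sum_comm]
    simp only [Finset.sum_product, curvatureCovKernel_apply, mul_ite, mul_zero, ite_mul, zero_mul]
    refine Finset.sum_congr rfl fun q _ => Finset.sum_congr rfl fun a _ => ?_
    rw [Finset.sum_ite_eq', if_pos (Finset.mem_univ _)]
    ring
  rw [e1, e2, e3] at hx
  exact hx


/-! ### Sub-additivity bounds for nonnegative "quadratic" functionals -/

/-- A nonnegative functional with `Φ 0 = 0` and `Φ(u + w) ≤ 2Φ(u) + 2Φ(w)` satisfies
`Φ(∑_{m∈M} u_m) ≤ 2^{|M|} ∑_{m∈M} Φ(u_m)`. -/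
theorem apply_sum_le_pow_mul_sum {V : Type*} [AddCommMonoid V] {ι : Type*} (Φ : V → ℝ)
    (h0 : Φ 0 = 0) (hnn : ∀ u, 0 ≤ Φ u) (hadd : ∀ u w, Φ (u + w) ≤ 2 * Φ u + 2 * Φ w)
    (M : Finset ι) (u : ι → V) :
    Φ (∑ m ∈ M, u m) ≤ 2 ^ M.card * ∑ m ∈ M, Φ (u m) := by
  classical
  induction M using Finset.induction_on with
  | empty => simp [h0]
  | insert m M hm ih =>
    rw [Finset.sum_insert hm, Finset.sum_insert hm, Finset.card_insert_of_notMem hm, pow_succ]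
    have hsum : 0 ≤ ∑ x ∈ M, Φ (u x) := Finset.sum_nonneg fun x _ => hnn _
    have h2 : (2 : ℝ) ≤ 2 ^ M.card * 2 := by
      have : (1 : ℝ) ≤ 2 ^ M.card := one_le_pow₀ (by norm_num)
      linarith
    calc Φ (u m + ∑ x ∈ M, u x) ≤ 2 * Φ (u m) + 2 * Φ (∑ x ∈ M, u x) := hadd _ _
      _ ≤ 2 * Φ (u m) + 2 * (2 ^ M.card * ∑ x ∈ M, Φ (u x)) := by linarith
      _ ≤ 2 ^ M.card * 2 * Φ (u m) + 2 ^ M.card * 2 * ∑ x ∈ M, Φ (u x) := by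
          have h1 := hnn (u m)
          nlinarith
      _ = 2 ^ M.card * 2 * (Φ (u m) + ∑ x ∈ M, Φ (u x)) := by ring

/-- `Q_S(u + w) ≤ 2 Q_S(u) + 2 Q_S(w)`. -/
theorem quad_add_le (S : Finset (ZdPlaquette 4)) (u v : ZdPlaquette 4 → Fin D → ℝ) :
    (∑ p ∈ S, ∑ q ∈ S, ∑ a : Fin D, (u + v) p a * (u + v) q a * curvatureTwoPoint p q) ≤
      2 * (∑ p ∈ S, ∑ q ∈ S, ∑ a : Fin D, u p a * u q a * curvatureTwoPoint p q) +
        2 * ∑ p ∈ S, ∑ q ∈ S, ∑ a : Fin D, v p a * v q a * curvatureTwoPoint p q := by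
  have h1 := quad_parallelogram S u v
  have h2 := stub_rigidityQuadNonneg D S (u - v)
  linarith

/-- `Q_S(∑_{m∈M} u_m) ≤ 2^{|M|} ∑_{m∈M} Q_S(u_m)`. -/
theorem quad_sum_le {ι : Type*} (M : Finset ι) (u : ι → ZdPlaquette 4 → Fin D → ℝ)
    (S : Finset (ZdPlaquette 4)) :
    (∑ p ∈ S, ∑ q ∈ S, ∑ a : Fin D, (∑ m ∈ M, u m) p a * (∑ m ∈ M, u m) q a *
        curvatureTwoPoint p q) ≤
      2 ^ M.card * ∑ m ∈ M, ∑ p ∈ S, ∑ q ∈ S, ∑ a : Fin D, u m p a * u m q a *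
        curvatureTwoPoint p q :=
  apply_sum_le_pow_mul_sum
    (fun w : ZdPlaquette 4 → Fin D → ℝ => ∑ p ∈ S, ∑ q ∈ S, ∑ a : Fin D,
      w p a * w q a * curvatureTwoPoint p q)
    (by simp) (fun w => stub_rigidityQuadNonneg D S w) (fun w w' => quad_add_le S w w') M u

/-- Second moments of pairings are sub-additive: `E⟨Y,u+w⟩² ≤ 2E⟨Y,u⟩² + 2E⟨Y,w⟩²`. -/
theorem msq_add_le {τ : Measure (ZdPlaquette 4 → Fin D → ℝ)}
    (hY : ∀ (p : ZdPlaquette 4) (a : Fin D), Integrable (fun Y => (Y p a) ^ 2) τ)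
    (S : Finset (ZdPlaquette 4)) (u v : ZdPlaquette 4 → Fin D → ℝ) :
    (∫ Y, (∑ p ∈ S, ∑ a : Fin D, (u + v) p a * Y p a) ^ 2 ∂τ) ≤
      2 * (∫ Y, (∑ p ∈ S, ∑ a : Fin D, u p a * Y p a) ^ 2 ∂τ) +
        2 * ∫ Y, (∑ p ∈ S, ∑ a : Fin D, v p a * Y p a) ^ 2 ∂τ := by
  have hi := integrable_pair_sq hY S u
  have hj := integrable_pair_sq hY S v
  calc (∫ Y, (∑ p ∈ S, ∑ a : Fin D, (u + v) p a * Y p a) ^ 2 ∂τ)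
      ≤ ∫ Y, (2 * (∑ p ∈ S, ∑ a : Fin D, u p a * Y p a) ^ 2 +
          2 * (∑ p ∈ S, ∑ a : Fin D, v p a * Y p a) ^ 2) ∂τ := by
        refine integral_mono (integrable_pair_sq hY S (u + v)) ((hi.const_mul 2).add (hj.const_mul 2))
          fun Y => ?_
        simp only [pair_add]
        nlinarith [sq_nonneg ((∑ p ∈ S, ∑ a : Fin D, u p a * Y p a) -
          ∑ p ∈ S, ∑ a : Fin D, v p a * Y p a)]
    _ = 2 * (∫ Y, (∑ p ∈ S, ∑ a : Fin D, u p a * Y p a) ^ 2 ∂τ) +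
        2 * ∫ Y, (∑ p ∈ S, ∑ a : Fin D, v p a * Y p a) ^ 2 ∂τ := by
        rw [integral_add (hi.const_mul 2) (hj.const_mul 2), integral_const_mul, integral_const_mul]

/-- `E⟨Y, ∑_{m∈M} u_m⟩² ≤ 2^{|M|} ∑_{m∈M} E⟨Y,u_m⟩²`. -/
theorem msq_sum_le {τ : Measure (ZdPlaquette 4 → Fin D → ℝ)}
    (hY : ∀ (p : ZdPlaquette 4) (a : Fin D), Integrable (fun Y => (Y p a) ^ 2) τ)
    {ι : Type*} (M : Finset ι) (u : ι → ZdPlaquette 4 → Fin D → ℝ) (S : Finset (ZdPlaquette 4)) :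
    (∫ Y, (∑ p ∈ S, ∑ a : Fin D, (∑ m ∈ M, u m) p a * Y p a) ^ 2 ∂τ) ≤
      2 ^ M.card * ∑ m ∈ M, ∫ Y, (∑ p ∈ S, ∑ a : Fin D, u m p a * Y p a) ^ 2 ∂τ :=
  apply_sum_le_pow_mul_sum
    (fun w : ZdPlaquette 4 → Fin D → ℝ => ∫ Y, (∑ p ∈ S, ∑ a : Fin D, w p a * Y p a) ^ 2 ∂τ)
    (by simp) (fun w => integral_nonneg fun Y => sq_nonneg _) (fun w w' => msq_add_le hY S w w') M u

/-! ### Reading `E cos`, `E sin` off the second moment -/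

/-- `0 ≤ 1 − E cos⟨Y,h⟩ ≤ E⟨Y,h⟩²/2` (probability measure). -/
theorem one_sub_integral_cos_mem {τ : Measure (ZdPlaquette 4 → Fin D → ℝ)} [IsProbabilityMeasure τ]
    (hY : ∀ (p : ZdPlaquette 4) (a : Fin D), Integrable (fun Y => (Y p a) ^ 2) τ)
    (S : Finset (ZdPlaquette 4)) (h : ZdPlaquette 4 → Fin D → ℝ) :
    0 ≤ 1 - ∫ Y, Real.cos (∑ p ∈ S, ∑ a : Fin D, h p a * Y p a) ∂τ ∧
      1 - ∫ Y, Real.cos (∑ p ∈ S, ∑ a : Fin D, h p a * Y p a) ∂τ ≤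
        (∫ Y, (∑ p ∈ S, ∑ a : Fin D, h p a * Y p a) ^ 2 ∂τ) / 2 := by
  have hm := continuous_pair S h
  have hcos : Integrable (fun Y => Real.cos (∑ p ∈ S, ∑ a : Fin D, h p a * Y p a)) τ := by
    refine Integrable.mono' (integrable_const (1 : ℝ)) (Real.continuous_cos.comp hm).aestronglyMeasurable
      (ae_of_all _ fun Y => ?_)
    simpa using Real.abs_cos_le_one _
  have e : 1 - ∫ Y, Real.cos (∑ p ∈ S, ∑ a : Fin D, h p a * Y p a) ∂τ =
      ∫ Y, (1 - Real.cos (∑ p ∈ S, ∑ a : Fin D, h p a * Y p a)) ∂τ := by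
    rw [integral_sub (integrable_const _) hcos]
    simp
  rw [e]
  constructor
  · exact integral_nonneg fun Y => by simpa using Real.cos_le_one _
  · rw [← integral_div]
    refine integral_mono ((integrable_const _).sub hcos) ((integrable_pair_sq hY S h).div_const _)
      fun Y => ?_
    have := Real.one_sub_sq_div_two_le_cos (x := ∑ p ∈ S, ∑ a : Fin D, h p a * Y p a)
    simp only
    linarith

/-- `|E sin⟨Y,h⟩| ≤ ε/2 + E⟨Y,h⟩²/(2ε)` for every `ε > 0`. -/
theorem abs_integral_sin_le {τ : Measure (ZdPlaquette 4 → Fin D → ℝ)} [IsProbabilityMeasure τ]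
    (hY : ∀ (p : ZdPlaquette 4) (a : Fin D), Integrable (fun Y => (Y p a) ^ 2) τ)
    (S : Finset (ZdPlaquette 4)) (h : ZdPlaquette 4 → Fin D → ℝ) {ε : ℝ} (hε : 0 < ε) :
    |∫ Y, Real.sin (∑ p ∈ S, ∑ a : Fin D, h p a * Y p a) ∂τ| ≤
      ε / 2 + (∫ Y, (∑ p ∈ S, ∑ a : Fin D, h p a * Y p a) ^ 2 ∂τ) / (2 * ε) := by
  calc |∫ Y, Real.sin (∑ p ∈ S, ∑ a : Fin D, h p a * Y p a) ∂τ|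
      ≤ ∫ Y, |Real.sin (∑ p ∈ S, ∑ a : Fin D, h p a * Y p a)| ∂τ := abs_integral_le_integral_abs
    _ ≤ ∫ Y, (ε / 2 + (∑ p ∈ S, ∑ a : Fin D, h p a * Y p a) ^ 2 / (2 * ε)) ∂τ := by
        refine integral_mono_of_nonneg (ae_of_all _ fun Y => abs_nonneg _)
          ((integrable_const _).add ((integrable_pair_sq hY S h).div_const _)) (ae_of_all _ fun Y => ?_)
        set x := ∑ p ∈ S, ∑ a : Fin D, h p a * Y p a
        have h1 : |Real.sin x| ≤ |x| := Real.abs_sin_le_abs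
        have h2 : |x| ≤ ε / 2 + x ^ 2 / (2 * ε) := by
          rw [div_add_div _ _ (two_ne_zero) (by positivity), le_div_iff₀ (by positivity)]
          nlinarith [sq_nonneg (|x| - ε), sq_abs x]
        exact h1.trans h2
    _ = ε / 2 + (∫ Y, (∑ p ∈ S, ∑ a : Fin D, h p a * Y p a) ^ 2 ∂τ) / (2 * ε) := by
        rw [integral_add (integrable_const _) ((integrable_pair_sq hY S h).div_const _), integral_const,
          integral_div]
        simp

end Rigidity


end Summit.QuantumFields.YangMills.Theorems.EquipartitionPinsProbe

end
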